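import Summits.Ventures.CertifiedArithmetic.LowPrec.DoubleRoundingStripLaws
import Summits.Ventures.CertifiedArithmetic.LowPrec.RoundSqrt

/-!
# The square-root precision strip is never innocuous (record-generic)

HONEST FRAMING: certified error envelopes and provably optimal rounding/accumulation schemes for
low-precision formats under stated cost models; every table by two implementations; no hardware or
vendor claims

WHAT. `DRSqrt φ ψ` (`RoundSqrt.lean`): one correctly rounded square root executed in the wide
format `ψ` and converted to `φ` is the correctly rounded square root of `φ`. The `13 × 13` named
matrix (`DoubleRoundingSqrtMatrix.lean`) observed that every innocuous named cell has
`P_ψ ≥ 2P + 2` or the same grid, and showed the clause attained at ONE cell. This file proves the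
NECESSITY of the precision clause for EVERY pair of records, not only the named ones:

* `not_drSqrt_of_gmid_below` — if the `ψ`-surrogate of `√a` lies strictly inside the lower
  `ψ`-neighbourhood `(μ - 2^r q_ψ, μ)` of an odd-over-even midpoint `μ = (2t+1) 2^k q_φ` of `φ`
  (`t` odd), certified by the two rational inequalities `(μ - 2^r q_ψ + q_ψ/2)² ≤ a < μ²`, then
  `fl_ψ (√a) = μ` and `fl_φ (μ) ≠ fl_φ (√a)`, so `¬ DRSqrt φ ψ`;
* `not_drSqrt_strip` — THE STRIP LAW: for records `φ ⊆ ψ` (aligned grids `hq`, nested ranges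
  `hM`) with `1 ≤ m_φ < m_ψ ≤ 2 m_φ + 2` (precisions `P < P_ψ ≤ 2P + 1`), `bias φ ≥ 2`,
  `bias ψ ≥ 3` and `4` a value of `φ`, `DRSqrt φ ψ` FAILS, at the operand
  `a = 4 - 2^(1 - m_φ)`: `√a` lies `≈ 2^(-2 m_φ - 4)` below the midpoint `μ = 2 - 2^(-m_φ - 1)`
  of `φ`, inside half a `ψ`-spacing (`2^(-m_ψ - 1) ≥ 2^(-2 m_φ - 3)`), so `fl_ψ (√a) = μ`, and
  `fl_φ (μ) = 2 ≠ 2 - 2^(-m_φ) = fl_φ (√a)` (ties-to-even at an odd lower neighbour).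

Together with (S) of `DoubleRoundingSqrt.lean` (`P_ψ ≥ 2P + 2 ⇒ DRSqrt`) this pins the
threshold `2P + 2` for square root on every pair of records in scope, as `2P` is pinned for
`×` and `÷` in `DoubleRoundingStripLaws.lean`.

KNOWN / REPRODUCTION. The innocuous side `p_ψ ≥ 2p + 2` is Figueroa 1995 §3 / Roux 2014 Thm 25;
that the bound is sharp is folklore (a counter-example for binary32/binary64-style pairs is in
every treatment); the record-generic failure family over aligned mini-float records with
subnormals and its kernel proof are [this packet]. No hardware or vendor claims.
-/

namespace Summit.Ventures.CertifiedArithmetic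

open Literature.ComputerArithmetic.FloatingPoint
open Literature.ComputerArithmetic.FloatingPoint.Format
open Literature.ComputerArithmetic.FloatingPoint.MiniFloat

/-! ## §1 A root just below an odd-over-even midpoint of the narrow format -/

/-- Slack inequality of the strip family: `(1 - u - w + ν)² ≤ 1 - 2u` for `2u ≤ 1/4`,
`w ≤ 1/16`, `4ν ≤ w`, `u² ≤ w` (all nonnegative). [this packet] -/
theorem sq_le_of_slack {u w ν : ℚ} (hu0 : 0 ≤ u) (hu : 2 * u ≤ 1 / 4) (hw0 : 0 ≤ w)
    (hw : w ≤ 1 / 16) (hν0 : 0 ≤ ν) (hν : 4 * ν ≤ w) (huw : u ^ 2 ≤ w) :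
    (1 - u - w + ν) ^ 2 ≤ 1 - 2 * u := by
  have h1 : (u + w - ν) ^ 2 ≤ (u + w) ^ 2 := by
    nlinarith [mul_nonneg hν0 (by linarith : 0 ≤ 2 * u + 2 * w - ν)]
  have h3 : 2 * u * w ≤ w / 4 := by nlinarith [mul_nonneg (by linarith : 0 ≤ 1 / 4 - 2 * u) hw0]
  have h4 : w ^ 2 ≤ w / 16 := by nlinarith [mul_nonneg (by linarith : 0 ≤ 1 / 16 - w) hw0]
  nlinarith [h1, h3, h4, huw]

/-- BELOW A MIDPOINT, CERTIFIED BY TWO INEQUALITIES. `φ ⊆ ψ` (`hq`, `hM`), `m_φ < m_ψ`,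
`μ = (2t+1) 2^k q_φ` a midpoint of `φ` with `t` odd and `2^r q_ψ ≤ ulp_ψ`-exponent slack
`hk'` (`r = m_φ + k + d - m_ψ`). If a value `a ≥ 0` of `φ` satisfies
`(μ - 2^r q_ψ + q_ψ / 2)² ≤ a < μ²`, then the `ψ`-surrogate of `√a` lies in
`(μ - 2^r q_ψ, μ)`, so `fl_ψ (√a) = μ` while `fl_φ (√a) < μ`'s upper neighbour `= fl_φ (μ)`:
`¬ DRSqrt φ ψ`. [this packet] -/
theorem not_drSqrt_of_gmid_below {φ ψ : Format} (hq : ψ.qexp ≤ φ.qexp)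
    (hM : φ.maxScaled * 2 ^ (φ.qexp - ψ.qexp).toNat ≤ ψ.maxScaled) (h1 : 1 ≤ φ.manBits)
    (hP : φ.manBits < ψ.manBits) {t k : ℕ} (ht : Odd t) (htlo : 2 ^ φ.manBits ≤ t)
    (hthi : t < 2 ^ (φ.manBits + 1)) (hu : (t + 1) * 2 ^ (k + 1) ≤ φ.maxScaled)
    (hk' : ψ.manBits ≤ φ.manBits + k + (φ.qexp - ψ.qexp).toNat) (a : MiniFloat φ)
    (ha0 : 0 ≤ a.toRat)
    (hhi : a.toRat < ((((2 * t + 1) * 2 ^ k : ℕ) : ℚ) * φ.quantum) ^ 2)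
    (hlo : ((((2 * t + 1) * 2 ^ k : ℕ) : ℚ) * φ.quantum -
      (2 ^ (φ.manBits + k + (φ.qexp - ψ.qexp).toNat + 1 - ψ.manBits) * ψ.quantum -
        ψ.quantum) / 2) ^ 2 ≤ a.toRat) :
    ¬ DRSqrt φ ψ := by
  intro hDR
  have hQ := ψ.quantum_pos
  have hquant : φ.quantum = 2 ^ (φ.qexp - ψ.qexp).toNat * ψ.quantum :=
    quantum_eq_two_pow_mul hq
  obtain ⟨r, hr⟩ := Nat.exists_eq_add_of_le hk'
  have hexp : φ.manBits + k + (φ.qexp - ψ.qexp).toNat + 1 - ψ.manBits = r + 1 := by omega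
  rw [hexp] at hlo
  obtain ⟨H, hH⟩ : ∃ H : ℕ, H = (2 * t + 1) * 2 ^ (k + (φ.qexp - ψ.qexp).toNat + 1) :=
    ⟨_, rfl⟩
  have hμ : (((2 * t + 1) * 2 ^ k : ℕ) : ℚ) * φ.quantum = (H : ℚ) * (ψ.quantum / 2) := by
    rw [hquant, hH]; push_cast; ring
  have hHr : 2 ^ (r + 1) ≤ H := by
    rw [hH]
    exact le_trans (Nat.pow_le_pow_right (by norm_num) (by omega))
      (Nat.le_mul_of_pos_left _ (by omega))
  -- the `ψ`-cell `h` of the root: `H - 2^(r+1) + 1 ≤ h` and `h + 1 ≤ H`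
  have hh1 : sqrtCell ψ a.toRat + 1 ≤ H := by
    by_contra hc
    have hc' : (H : ℚ) ≤ sqrtCell ψ a.toRat := by
      exact_mod_cast (by omega : H ≤ sqrtCell ψ a.toRat)
    have h2 := sqrtCell_sq_le (φ := ψ) ha0
    have h3 : ((H : ℚ) * (ψ.quantum / 2)) ^ 2 ≤
        ((sqrtCell ψ a.toRat : ℚ) * (ψ.quantum / 2)) ^ 2 :=
      pow_le_pow_left₀ (by positivity) (mul_le_mul_of_nonneg_right hc' (by positivity)) 2
    rw [hμ] at hhi
    linarith
  have hh2 : H - 2 ^ (r + 1) + 1 ≤ sqrtCell ψ a.toRat := by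
    refine le_sqrtCell_of_sq_le (φ := ψ) ?_
    have hc : ((H - 2 ^ (r + 1) + 1 : ℕ) : ℚ) * (ψ.quantum / 2) =
        (H : ℚ) * (ψ.quantum / 2) - (2 ^ (r + 1) * ψ.quantum - ψ.quantum) / 2 := by
      rw [Nat.cast_add, Nat.cast_sub hHr]; push_cast; ring
    rw [hc, ← hμ]; exact hlo
  have hx1 := sqrtCell_mul_le_sqrtSurr (φ := ψ) a.toRat
  have hx2 := sqrtSurr_lt (φ := ψ) a.toRat
  obtain ⟨δ, hδ⟩ : ∃ δ : ℚ, δ = (H : ℚ) * (ψ.quantum / 2) - sqrtSurr ψ a.toRat := ⟨_, rfl⟩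
  have hc1 : ((sqrtCell ψ a.toRat : ℚ) + 1) * (ψ.quantum / 2) ≤ (H : ℚ) * (ψ.quantum / 2) :=
    mul_le_mul_of_nonneg_right (by exact_mod_cast hh1) (by positivity)
  have hc2 : (H : ℚ) + 1 ≤ sqrtCell ψ a.toRat + 2 ^ (r + 1) := by
    exact_mod_cast (by omega : H + 1 ≤ sqrtCell ψ a.toRat + 2 ^ (r + 1))
  have hδ0 : 0 < δ := by rw [hδ]; linarith
  have hδψ : 2 * δ < 2 ^ (φ.manBits + k + (φ.qexp - ψ.qexp).toNat + 1 - ψ.manBits) *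
      ψ.quantum := by
    rw [hexp, hδ]; nlinarith [mul_le_mul_of_nonneg_right hc2 hQ.le]
  have e := hDR a ha0
  rw [← toRat_roundNE_sqrtSurr hq ha0] at e
  unfold roundNESqrt at e
  have hxe : sqrtSurr ψ a.toRat = (((2 * t + 1) * 2 ^ k : ℕ) : ℚ) * φ.quantum - δ := by
    rw [hδ, hμ]; ring
  rw [hxe] at e
  exact roundNE_roundNE_ne_gmid_below hq hM h1 hP ht htlo hthi hu hk' hδ0 hδψ e

/-! ## §2 The strip law for square root -/

/-- THE SQUARE-ROOT STRIP LAW (record-generic). For records `φ ⊆ ψ` (`hq`: aligned grids, `hM`: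
nested ranges) with `1 ≤ m_φ < m_ψ ≤ 2 m_φ + 2` — precisions `P < P_ψ ≤ 2P + 1` — `bias φ ≥ 2`,
`bias ψ ≥ 3` and `4` a value of `φ` (`hR`), ONE square root in `ψ` converted to `φ` is NOT the
correctly rounded square root of `φ`: the operand `a = 4 - 2^(1-m_φ)` has
`fl_φ (fl_ψ (√a)) = 2 ≠ 2 - 2^(-m_φ) = fl_φ (√a)`. With (S) `P_ψ ≥ 2P + 2 ⇒ DRSqrt`
(`DoubleRoundingSqrt.lean`) the threshold `2P + 2` is exact on every such pair.
[this packet; cite: Figueroa1995, §3; cite: Roux2014, Thm 25] -/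
theorem not_drSqrt_strip {φ ψ : Format} (hq : ψ.qexp ≤ φ.qexp)
    (hM : φ.maxScaled * 2 ^ (φ.qexp - ψ.qexp).toNat ≤ ψ.maxScaled) (h1 : 1 ≤ φ.manBits)
    (hP : φ.manBits < ψ.manBits) (hP2 : ψ.manBits ≤ 2 * φ.manBits + 2) (hb : 2 ≤ φ.bias)
    (hb' : 3 ≤ ψ.bias) (hR : 2 ^ (φ.manBits + φ.bias + 1) ≤ φ.maxScaled) : ¬ DRSqrt φ ψ := by
  obtain ⟨k, hk⟩ := Nat.exists_eq_add_of_le' hb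
  obtain ⟨k', hk2⟩ := Nat.exists_eq_add_of_le' hb'
  obtain ⟨M, hMm⟩ : ∃ M, 2 ^ φ.manBits = M + 1 :=
    ⟨2 ^ φ.manBits - 1, by have := Nat.one_le_two_pow (n := φ.manBits); omega⟩
  have hMq : (2 : ℚ) ^ φ.manBits = M + 1 := by exact_mod_cast hMm
  have hQ := quantum_eq_one_div (φ := φ) (k := k + 1) (by omega)
  rw [hMq] at hQ
  have hQ' := quantum_eq_one_div (φ := ψ) (k := k' + 2) (by omega)
  have hdB := manBits_add_bias_add_toNat hq
  have hM0 : (0 : ℚ) ≤ M := Nat.cast_nonneg M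
  have hM1 : (1 : ℚ) ≤ M := by
    have h2 : 2 ≤ M + 1 := by
      rw [← hMm]; exact le_trans (by norm_num) (Nat.pow_le_pow_right (by norm_num) h1)
    exact_mod_cast (by omega : 1 ≤ M)
  -- the operand `a = (2M+1) 2^(k+2) q_φ = 4 - 2^(1-m)` and the midpoint data `t = 2M+1`, `k`
  have haR : (2 * M + 1) * 2 ^ (k + 2) ≤ φ.maxScaled := by
    refine le_trans ?_ hR
    rw [hk, show φ.manBits + (k + 2) + 1 = φ.manBits + 1 + (k + 2) by omega,
      pow_add 2 (φ.manBits + 1) (k + 2), pow_succ 2 φ.manBits, hMm]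
    exact Nat.mul_le_mul_right _ (by omega)
  obtain ⟨a, ha⟩ := exists_toRat_eq_natMul
    (representable_mul_pow (φ := φ) (k := 2 * M + 1) (j := k + 2)
      (by rw [pow_succ, hMm]; omega) haR)
  have ha0 : 0 ≤ a.toRat := by rw [ha]; have := φ.quantum_pos; positivity
  have hu : (2 * M + 1 + 1) * 2 ^ (k + 1) ≤ φ.maxScaled := by
    refine le_trans ?_ haR
    calc (2 * M + 1 + 1) * 2 ^ (k + 1) ≤ 2 * (2 * M + 1) * 2 ^ (k + 1) :=
          Nat.mul_le_mul_right _ (by omega)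
      _ = (2 * M + 1) * 2 ^ (k + 2) := by ring
  have hk' : ψ.manBits ≤ φ.manBits + k + (φ.qexp - ψ.qexp).toNat := by omega
  have hx : φ.manBits + k + (φ.qexp - ψ.qexp).toNat + 1 - ψ.manBits = k' + 2 := by omega
  have hsp : (2 : ℚ) ^ (k' + 2) * ψ.quantum = 1 / 2 ^ ψ.manBits := by rw [hQ']; field_simp
  have hμ : (((2 * (2 * M + 1) + 1) * 2 ^ k : ℕ) : ℚ) * φ.quantum =
      (4 * M + 3) / (2 * (M + 1)) := by
    rw [hQ]; push_cast; field_simp; ring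
  have haval : a.toRat = (4 * M + 2) / (M + 1) := by rw [ha, hQ]; push_cast; field_simp; ring
  -- `a < μ²`: `(4M+2) 4 (M+1)² + (M+1) = (4M+3)² (M+1)`
  have hhi : a.toRat < ((((2 * (2 * M + 1) + 1) * 2 ^ k : ℕ) : ℚ) * φ.quantum) ^ 2 := by
    rw [hμ, haval, div_pow, div_lt_div_iff₀ (by positivity) (by positivity)]
    nlinarith
  -- `(μ - 2^r q_ψ + q_ψ/2)² ≤ a`: the slack inequality with `u = 2^(-m-2)`, `w = 2^(-m_ψ-2)`
  have hW4 : (4 : ℚ) ≤ 2 ^ ψ.manBits :=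
    le_trans (by norm_num) (pow_le_pow_right₀ (by norm_num : (1 : ℚ) ≤ 2) (by omega :
      2 ≤ ψ.manBits))
  have hK4 : (4 : ℚ) ≤ 2 ^ (k' + 2) :=
    le_trans (by norm_num) (pow_le_pow_right₀ (by norm_num : (1 : ℚ) ≤ 2) (by omega :
      2 ≤ k' + 2))
  have hWM : (2 : ℚ) ^ ψ.manBits ≤ 4 * (M + 1) ^ 2 := by
    rw [← hMq]
    calc (2 : ℚ) ^ ψ.manBits ≤ 2 ^ (2 * φ.manBits + 2) := pow_le_pow_right₀ (by norm_num) hP2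
      _ = 4 * (2 ^ φ.manBits) ^ 2 := by ring
  have hu2 : 2 * (1 / (4 * ((M : ℚ) + 1))) ≤ 1 / 4 := by
    rw [mul_one_div, div_le_div_iff₀ (by positivity) (by norm_num)]; nlinarith
  have hw16 : 1 / (4 * (2 : ℚ) ^ ψ.manBits) ≤ 1 / 16 :=
    one_div_le_one_div_of_le (by norm_num) (by linarith)
  have hν4 : 4 * (1 / (4 * (2 : ℚ) ^ ψ.manBits * 2 ^ (k' + 2))) ≤ 1 / (4 * 2 ^ ψ.manBits) := by
    rw [show (4 : ℚ) * (1 / (4 * 2 ^ ψ.manBits * 2 ^ (k' + 2))) =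
      1 / (2 ^ ψ.manBits * 2 ^ (k' + 2)) by field_simp]
    have hK0 : (0 : ℚ) ≤ 2 ^ ψ.manBits * (2 ^ (k' + 2) - 4) :=
      mul_nonneg (by positivity) (by linarith)
    exact one_div_le_one_div_of_le (by positivity) (by nlinarith [hK0])
  have huw : (1 / (4 * ((M : ℚ) + 1))) ^ 2 ≤ 1 / (4 * 2 ^ ψ.manBits) := by
    rw [show (1 / (4 * ((M : ℚ) + 1))) ^ 2 = 1 / (16 * (M + 1) ^ 2) by field_simp; ring]
    exact one_div_le_one_div_of_le (by positivity) (by linarith)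
  have key := sq_le_of_slack (by positivity) hu2 (by positivity) hw16 (by positivity) hν4 huw
  have hlo : ((((2 * (2 * M + 1) + 1) * 2 ^ k : ℕ) : ℚ) * φ.quantum -
      (2 ^ (φ.manBits + k + (φ.qexp - ψ.qexp).toNat + 1 - ψ.manBits) * ψ.quantum -
        ψ.quantum) / 2) ^ 2 ≤ a.toRat := by
    rw [hx, hsp, hQ', hμ, haval]
    calc _ = 4 * (1 - 1 / (4 * ((M : ℚ) + 1)) - 1 / (4 * 2 ^ ψ.manBits) +
            1 / (4 * 2 ^ ψ.manBits * 2 ^ (k' + 2))) ^ 2 := by field_simp; ring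
      _ ≤ 4 * (1 - 2 * (1 / (4 * ((M : ℚ) + 1)))) := by linarith [key]
      _ = _ := by field_simp; ring
  exact not_drSqrt_of_gmid_below hq hM h1 hP (t := 2 * M + 1) (k := k) ⟨M, rfl⟩
    (by rw [hMm]; omega) (by rw [pow_succ, hMm]; omega) hu hk' a ha0 hhi hlo

/-! ## §3 Kernel instances on named records -/

/-- `binary8p5 → binary16` (`P = 5`, `P_ψ = 11 ≤ 12`), `e3m2 → e4m3` and `e3m2 → binary8p4`
(`P = 3`, `P_ψ = 4`) fail for `√` by the strip law (these cells are also in the witness table of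
`DoubleRoundingSqrtTables.lean`). -/
example : ¬ DRSqrt Binary8p5 Binary16 ∧ ¬ DRSqrt E3M2 E4M3 ∧ ¬ DRSqrt E3M2 Binary8p4 := by
  refine ⟨?_, ?_, ?_⟩ <;>
    exact not_drSqrt_strip (by decide) (by decide +kernel) (by decide) (by decide) (by decide)
      (by decide) (by decide) (by decide +kernel)

end Summit.Ventures.CertifiedArithmetic
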